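import Summits.CriticalPhenomena.Ising3DConformalLimit.Theses.EnergyNotSigmaSquared
import Summits.CriticalPhenomena.Ising3DConformalLimit.Theorems.GapForcesFarMerging.Negative.SoftShapes
import Literature.Probability.LatticeModels.SourcedDoubleCurrentsSwitching
import Literature.Probability.Percolation.ConstrainedClusters

/-!
# Line `backbone-transparency-dichotomy` — checked skeleton for crux `GapForcesFarMerging`
# (item stmt-CriticalPhenomena-4468, route EnergyNotSigmaSquared, rank 2)

Crux (by name): `Summit.CriticalPhenomena.Ising3DConformalLimit.Theses.EnergyNotSigmaSquared.GapForcesFarMerging`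
`= EnergyGapPowerLaw → FarMergingShape cc2 (criticalCorr 3 4)` (`Negative.SoftShapes.crux_iff`, `Iff.rfl`).

## The lever (idea card `backbone-transparency-dichotomy`, ideator 1, round 1)

Put hypothesis and conclusion on ONE random set and ONE deterministic functional.
* ONE SET: the duplicated critical cluster `C = C_{n₁+n₂}(o)` of a sourced pair `∂n₁ = {o,x}`, `∂n₂ = ∅`
  (box law `sourcedDoubleCurrentLaw 3 n β_c ({o} ∆ {x}) ∅` of the trace, ADC21 §3.1, in tree).
* ONE FUNCTIONAL: the TRANSPARENCY (screening ratio) of a finite obstacle `T` for a probe pair `(a,b)`,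
  `S⁽ⁿ⁾_{ab}(T) = ⟨σ_aσ_b⟩_{Λ_n∖T}/⟨σ_aσ_b⟩_{Λ_n} ∈ [0,1]` (free b.c. on the region `Λ_n ∖ T` deletes exactly
  the bonds meeting `T`). By Aizenman's backbone expansion `⟨σ_aσ_b⟩_{Λ∖T} = ∑_{ω ⊂ Λ∖T} ρ_{Λ∖T}(ω)` and
  `ρ_{Λ∖T}(ω) = ρ_Λ(ω)·Φ_Λ(ω̃,T)` with the loop factor `Φ = Z_{Λ∖T∖ω̃}Z_Λ/(Z_{Λ∖T}Z_{Λ∖ω̃}) ≥ 1`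
  (Aizenman 1982 Lemma 9.3 / AF86 super-multiplicativity, tree `Current.ecurrentSum_koff_union_mul_ge`):
  `S_{ab}(T) = E^{ab}_ω[𝟙[ω̃ ∩ T = ∅]·Φ]` — "transparency × loop factor". We keep `S` EXACT throughout (the
  loop factor is never estimated), so no single-versus-double gap appears anywhere on this line.
* EXACT IDENTITIES (ADC21 Lemma A.1, tree `Current.tsum_epairWeight_eq_tsum_mul_offRatio`; ADC21 (3.11),
  tree `connectedFour_free_box_eq`): two-current avoidance `P^{ox}⊗P^{ab}[o ↮ a] = E^{ox,∅}[𝟙[a,b ∉ C]·S_{ab}(C)]`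
  (MEAN TRANSPARENCY) and `P^{y₀y₁}⊗P^{y₂y₃}[merge] = 1 - E^{y₀y₁,∅}[𝟙·S_{y₂y₃}(C)]` (FAR MERGING = MEAN
  OPACITY, with equality).
* MONOTONE SCALE TELESCOPING: `T ↦ S_{ab}(T)` is non-increasing (Griffiths II in deleted bonds, tree
  `Current.offRatio_pair_mul_le`), so along the cluster explored from `o` inside `Λ_r`, `r ↑`, the mean
  transparency `t(r)` decreases monotonically from `O(1)` to the avoidance probability; a power-law decay is a
  product of per-octave factors `h_k = t(2^k)/t(2^{k-1}) ∈ (0,1]`, and the DICHOTOMY per octave is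
  transparent (`h_k ≥ 1 - c`) / opaque (`h_k < 1 - c`).

## The line (4 stubs; `line_closes` composes their statements sorry-free, `GapForcesFarMerging_of` concludes the crux by name from the stubs; no sorry outside `stub_*`)

GAP →(S1 `stub_onePinchDecay`: RP Cauchy–Schwarz un-pinching of the far end + Lemma A.1 dictionary + MMS
folding at doubling scales) one-pinch mean transparency `≤ C t^{-κ'}` for infinitely many far scales `t`
→(S2 `stub_opaqueScales`: monotone telescoping + per-octave transparency FLOOR + counting) unboundedly many
OPAQUE octaves, each inside a doubling window of the two-point function →(S3 `stub_farOpacity`, HARDEST: un-tilt (one-set decoupling) + source relocation (two-point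
Harnack at the opaque scale) + finite-shape pigeonhole) a fixed far shape is opaque along infinitely many
dilations →(S4 `stub_farMerging`: far merging = mean opacity, exactly, + box limits) `FarMergingShape cc2
(criticalCorr 3 4)`.

## Disproof used (tree `Cruxes/GapForcesFarMerging/Disproof.lean` v6/v7 and `Theorems/…/Negative/SoftShapes.lean`)

* `gapForcesFarMerging_false_without_model` (the MODEL is load-bearing; a proof must couple quadruples of
  different shape/scale ON THE LATTICE): honoured at S2 (telescoping couples all scales `2^k ≤ t` of one
  cluster) and S3 (couples the opaque octave to a dilated fixed shape); every stub is a statement about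
  sourced double currents / depleted Ising correlations of the actual n.n. model on `ℤ³`, none is a
  "soft package" consequence; `gapShape_not_determined_by_bulk`: no stub passes through a scaling limit.
* `cruxWithoutKappaPos_iff` (gen-1; `0 < κ` load-bearing): `κ > 0` is consumed in S2 (a power `t^{-κ'}`
  spread over `log₂ t` octaves each costing at most a bounded factor forces `≍ log t` opaque octaves; a soft
  `o(1)` gap forces nothing).
* gen-1 §7 `io_ge_of_prod_le_two_pow` / `density_of_prod_le_two_pow` / `io_ge_needs_lt_one`: S2's counting is
  exactly this bookkeeping, and its FLOOR hypothesis is the printed missing input `m_k ≤ 1 - δ`, made a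
  named part of S2 rather than assumed.
* `oneEndedGapForcesFarMerging_false_without_model`: the one-pinch residual is not soft either — agreed;
  S2–S3 are current-level statements, not package consequences.
* `farMerging_const_le_two`, `farMergingFor_criticalCorr_iff_merge` (gen-1): S4 is their finite-volume,
  transparency-language form.
No stub is an instance of a landed Negative lemma: the Negative files refute only package-level
("without model") transfers and the `κ = 0` / `x = 0` degenerations, none of which is asserted here.
-/

noncomputable section

namespace Summit.CriticalPhenomena.Ising3DConformalLimit.Cruxes.GapForcesFarMerging.BackboneTransparencyDichotomy

open scoped symmDiff
open MeasureTheory Filter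
open Literature.Probability.LatticeModels Literature.Probability.Percolation
open Summit.CriticalPhenomena.Ising3DConformalLimit.Theses.EnergyNotSigmaSquared
open Summit.CriticalPhenomena.Ising3DConformalLimit.Theorems.GapForcesFarMerging.Negative (cc2 FarMergingShape)

/-! ## Vocabulary (all over existing declarations; finite volume `Λ_n = box 3 n`, `β = β_c(3)`) -/

/-- `e₁ = (1,0,0)`: the axis carrying the far scale. [folklore] -/
abbrev e₁ : Site 3 := Pi.single 0 1
/-- `e₂ = (0,1,0)`: the bond direction of GAP (`ε₀ = σ₀σ_{e₂}`). [folklore] -/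
abbrev e₂ : Site 3 := Pi.single 1 1
/-- `e₃ = (0,0,1)`: the transverse direction separating the un-pinched far ends. [folklore] -/
abbrev e₃ : Site 3 := Pi.single 2 1

/-- The depleted box two-point function `⟨σ_aσ_b⟩_{Λ_n ∖ T}` at `β_c(3)`: free boundary condition on the
region `Λ_n ∖ T`, which deletes exactly the nearest-neighbour bonds meeting `T` (the restricted state of
ADC21 Lemma A.1; `T = ∅` gives `⟨σ_aσ_b⟩⁰_{Λ_n}`). [cite: AizenmanDuminilCopinAnnals2021, App. A, Lemma A.1] -/
def boxTwoPoint (n : ℕ) (T : Finset (Site 3)) (a b : Site 3) : ℝ :=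
  isingTwoPoint (zdGraph 3) (box 3 n \ T) (criticalBeta 3) 0 .free a b

/-- TRANSPARENCY (screening ratio) of the obstacle `T` for the probe pair `(a,b)` in `Λ_n`:
`S⁽ⁿ⁾_{ab}(T) = ⟨σ_aσ_b⟩_{Λ_n∖T} / ⟨σ_aσ_b⟩_{Λ_n} ∈ [0,1]`, non-increasing in `T` (Griffiths II);
`1 - S` is the OPACITY. [cite: AizenmanDuminilCopinAnnals2021, App. A, Lemma A.1] -/
def transparency (n : ℕ) (T : Finset (Site 3)) (a b : Site 3) : ℝ :=
  boxTwoPoint n T a b / boxTwoPoint n ∅ a b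

open Classical in
/-- The cluster of `o` EXPLORED INSIDE `Λ_r`: vertices of `Λ_r` joined to `o` by open bonds of `ω` with
both endpoints in `Λ_r` (a stopping set for the domain-Markov decomposition of the current pair; it
increases with `r` and is the whole cluster `C_{n₁+n₂}(o)` once `Λ_r` contains the trace). [cite: AizenmanDuminilCopinAnnals2021, §6.2] -/
def innerCluster (r : ℕ) (o : Site 3) (ω : BondConfig (Site 3)) : Finset (Site 3) :=
  (box 3 r).filter fun v => v ∈ openClusterIn (withinGraph (zdGraph 3) (↑(box 3 r) : Set (Site 3))) ω o

open Classical in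
/-- The transparency functional of the explored duplicated cluster, `𝟙[a,b ∉ C(o)] · S⁽ⁿ⁾_{ab}(C_r(o))`
(zero as soon as a probe point is swallowed by the full cluster). Pointwise non-increasing in `r`. [cite: AizenmanDuminilCopinAnnals2021, App. A, Lemma A.1] -/
def clusterTransparency (n r : ℕ) (o a b : Site 3) (ω : BondConfig (Site 3)) : ℝ :=
  if a ∈ openCluster ω o ∨ b ∈ openCluster ω o then 0 else transparency n (innerCluster r o ω) a b

/-- MEAN TRANSPARENCY `t⁽ⁿ⁾_r(o,x ; a,b) = 𝔼^{ox,∅}_{Λ_n,β_c}[𝟙[a,b ∉ C(o)]·S⁽ⁿ⁾_{ab}(C_r(o))]` under the box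
law of the trace of the sourced pair `∂n₁ = {o} ∆ {x}`, `∂n₂ = ∅`. For `r = n` (full cluster) Lemma A.1
makes it EQUAL to the two-current avoidance probability `P^{ox}_{Λ_n}⊗P^{ab}_{Λ_n}[o ↮ a]`. [cite: AizenmanDuminilCopinAnnals2021, App. A, Lemma A.1] -/
def meanTransparency (n r : ℕ) (o x a b : Site 3) : ℝ :=
  ∫ ω, clusterTransparency n r o a b ω ∂(sourcedDoubleCurrentLaw 3 n (criticalBeta 3) ({o} ∆ {x}) ∅)

/-- Far source of the ONE-PINCH configuration at scale `t`: `p_t = (t,0,t)`. [folklore] -/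
def pSrc (t : ℕ) : Site 3 := (t : ℤ) • e₁ + (t : ℤ) • e₃
/-- Far probe end of the one-pinch configuration at scale `t`: `q_t = (t,0,-t)` (`‖p_t - q_t‖ = 2t`). [folklore] -/
def qPrb (t : ℕ) : Site 3 := (t : ℤ) • e₁ - (t : ℤ) • e₃

/-- ONE-PINCH MEAN TRANSPARENCY `u⁽ⁿ⁾(r,t)`: cluster of the pair `(0, p_t)` explored inside `Λ_r`, probed by
the pair `(e₂, q_t)` — one adjacent pinch `(0,e₂)` at the origin, far ends `p_t, q_t` un-pinched. [folklore] -/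
def onePinch (n r t : ℕ) : ℝ := meanTransparency n r 0 (pSrc t) e₂ (qPrb t)

/-! ## Currencies of the line -/

/-- (T1) ONE-PINCH TRANSPARENCY DECAY: for infinitely many far scales `t`, eventually in the box size,
`u⁽ⁿ⁾(n,t) ≤ C t^{-κ'}` with `κ' > 0` — the duplicated cluster of `(0,p_t)` screens the single adjacent
probe `e₂` from the far point `q_t` polynomially. (Output of S1; predicted `κ' = κ/2 = Δ_ε - 2Δ_σ ≈ 0.376`.) [cite: AizenmanDuminilCopinAnnals2021, eq. (3.7)] -/
def OnePinchTransparencyDecay : Prop :=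
  ∃ κ C : ℝ, 0 < κ ∧ ∃ᶠ t : ℕ in atTop, ∀ᶠ n : ℕ in atTop, onePinch n n t ≤ C * (t : ℝ) ^ (-κ)

/-- DOUBLING WINDOW at octave `k` with constant `θ`: `G(2^{j+1}e₁) ≥ θ·G(2^j e₁)` for the seven octaves
`|j - k| ≤ 3` (`G = criticalTwoPoint 3`). With Messager–Miracle-Solé folding this is ADC21's regularity
property P1 on `Λ_{2^{k+3}} ∖ Λ_{2^{k-3}}` (all values of `G(0,·)` there agree within `θ^{O(1)}`); since
`∏_{j<J} G(2^{j+1}e₁)/G(2^je₁) ≥ c4^{-J}` (`criticalTwoPoint_bounds_holds`), the octaves WITHOUT a `θ`-window have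
upper density `≤ 7·log 4/log(1/θ)`, as small as desired. [cite: AizenmanDuminilCopinAnnals2021, Def. 5.11 (P1)] -/
def DoublingWindow (θ : ℝ) (k : ℕ) : Prop :=
  ∀ j : ℕ, k ≤ j + 3 → j ≤ k + 3 →
    θ * criticalTwoPoint 3 (((2 : ℤ) ^ j) • e₁) ≤ criticalTwoPoint 3 (((2 : ℤ) ^ (j + 1)) • e₁)

/-- (T2) OPAQUE OCTAVES, UNBOUNDEDLY MANY, INSIDE DOUBLING WINDOWS: there are `c, θ > 0` such that for
infinitely many octaves `k` — each carrying a `θ`-doubling window — some far scale `t ≥ 2^{k+2}` has, for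
infinitely many box sizes, a RELATIVE transparency drop of at least `c` across the octave:
`0 < u(2^k,t) ≤ (1-c)·u(2^{k-1},t)` — deleting the bonds of the explored cluster in the annulus
`Λ_{2^k} ∖ Λ_{2^{k-1}}` on top of the inner ones costs a definite fraction of the (tilted) mean transparency,
i.e. the depleted probe strand is forced through that annulus piece with probability `≥ c`. (Output of S2:
opaque octaves have positive lower density `ρ₀(κ',δ)` below `log₂ t`, windows have density `→ 1` as `θ → 0`,
so the two sets meet unboundedly often.) [folklore] -/
def OpaqueScalesIO : Prop :=
  ∃ c θ : ℝ, 0 < c ∧ 0 < θ ∧ ∃ᶠ k : ℕ in atTop, DoublingWindow θ k ∧ ∃ t : ℕ, 2 ^ (k + 2) ≤ t ∧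
    ∃ᶠ n : ℕ in atTop, 0 < onePinch n (2 ^ k) t ∧ onePinch n (2 ^ k) t ≤ (1 - c) * onePinch n (2 ^ (k - 1)) t

/-- (T3) FAR OPACITY ALONG DILATIONS OF ONE SHAPE: some injective lattice quadruple `y` and `c > 0` such that
for infinitely many `L`, for infinitely many box sizes, the full duplicated cluster of `(Ly₀, Ly₁)` screens
the far pair `(Ly₂, Ly₃)` by a definite fraction: mean transparency `≤ 1 - c`. (Output of S3.) [cite: AizenmanCMP1982, Prop. 5.3] -/
def FarOpacityIO : Prop :=
  ∃ c : ℝ, 0 < c ∧ ∃ y : Fin 4 → Site 3, Function.Injective y ∧ ∀ L₀ : ℕ, ∃ L : ℕ, L₀ ≤ L ∧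
    ∃ᶠ n : ℕ in atTop,
      meanTransparency n n ((L : ℤ) • y 0) ((L : ℤ) • y 1) ((L : ℤ) • y 2) ((L : ℤ) • y 3) ≤ 1 - c

/-! ## The four stubs -/

/-- **S1 — GAP un-pinched into the transparency currency.** `EnergyGapPowerLaw` (two adjacent pinches,
spin language) ⇒ one-pinch mean-transparency decay with exponent `κ/2` along infinitely many far scales.
Intended proof (every ingredient a tree theorem): (i) reflection positivity through the site plane
`{u₀ = t/2}` (`isingTorus_reflectionPositive_sites_holds` + uniqueness `hasUniqueGibbsMeasure_criticalBeta_holds`)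
and `rp_cauchySchwarz_holds` for `F = ε₀ - ⟨ε₀⟩`, `G = σ_{te₃}σ_{-te₃} - ⟨⟩` give
`⟨ε₀ ; σ_{p_t}σ_{q_t}⟩² ≤ ⟨ε₀ ; ε_{te₁}⟩ · ⟨σ_{te₃}σ_{-te₃} ; σ_{p_t}σ_{q_t}⟩ ≤ GAP(te₁) · 2G(te₁)²`
(Lebowitz `criticalUrsellFour_nonpos` + MMS for the pair–pair factor), the siblings' `OneEndedGap`;
(ii) the switching line `⟨ε₀;σ_pσ_q⟩ = G(0,p)G(e₂,q)·A^{par} + G(0,q)G(e₂,p)·A^{cross}` (route item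
EnergyFactorisation 4472, `ursellFour_eq_doubleCurrent_holds`) and Lemma A.1
(`Current.tsum_epairWeight_eq_tsum_mul_offRatio`, `F = 𝟙[e₂ ∉ C]`) identify `A^{par}_{Λ_n} = u⁽ⁿ⁾(n,t)`;
(iii) `G(0,p_t) ≥ G(2te₁)`, `G(e₂,q_t) ≥ G((2t+1)e₁) ≥ G(4te₁)` (Messager–Miracle-Solé folding through
the diagonal planes `u₀ - u₂ = t`, `u₀ - u₁ = 2t` and axis monotonicity: `messager_miracleSole_diag_free`,
`freeCorr_pair_diagRefl_le`, `twoPointFree_add_single_le`, with `twoPointPlus_criticalBeta_eq_twoPointFree_holds`)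
and `G(4te₁) ≥ G(te₁)/64` at the infinitely many DOUBLING scales `t = 2^j` (if `G(2^{j+2}e₁) < G(2^je₁)/64`
for all large `j` then `G(2^je₁) = O(8^{-j})`, contradicting `G ≥ c‖x‖⁻²`, `criticalTwoPoint_bounds_holds`;
no ADC21 regularity needed);
(iv) box limits `criticalCorr_wellDefined_holds`. Size L (plumbing-heavy, no open input). [cite: AizenmanDuminilCopinAnnals2021, eq. (3.7) and Lemma A.1] -/
theorem stub_onePinchDecay : EnergyGapPowerLaw → OnePinchTransparencyDecay := by
  sorry

/-- **S2 — monotone telescoping and the transparency floor: opaque octaves.** Intended proof: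
(a) `r ↦ u⁽ⁿ⁾(r,t)` is non-increasing (the explored cluster grows with `r`, `S` is Griffiths-antitone in the
obstacle: `Current.offRatio_pair_mul_le` / free-b.c. volume monotonicity) and `u(n,t)` is the full avoidance;
(b) FLOOR (the content; = the separation input (S) of Disproof §7 in transparency clothing, and the printed
missing hypothesis `m_k ≤ 1-δ` of `density_of_prod_le_two_pow`): there is `δ > 0` with
`u(2^k,t) ≥ δ·u(2^{k-1},t)` for `1 ≤ k`, `2^{k+2} ≤ t`, and `u(n,t) ≥ δ·u(2^{K-2},t)` for `2^K ≤ t < 2^{K+1}`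
(one octave of duplicated cluster, resp. the un-pinched bulk, never costs more than a bounded factor of
tilted mean transparency), uniformly in `t` and in large `n`; also `u(1,t) ≥ δ` (insertion tolerance / finite energy of the current pair near the origin,
`CurrentInsertion.lean`, `IsingFiniteEnergy.lean`, and a Lieb–Simon decoupling `LocalSimonLieb.lean` /
`ModifiedSimonInequality.lean` for the uniformity in the far ends `p_t, q_t`); (c) counting (gen-1 Disproof `density_of_prod_le_two_pow`): `C t^{-κ'} ≥ u(n,t) = u(1,t)·∏_{k ≤ K-2} h_k ·
(bulk factor)` with every factor `≥ δ` forces `#{k ≤ K-2 : h_k ≤ 1-c} ≥ ρ₀K - O(1)`, `ρ₀ = ρ₀(κ',δ) > 0`, for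
`c = c(κ',δ)`; the `θ`-doubling windows (`DoublingWindow`, pigeonhole on `criticalTwoPoint_bounds_holds`) miss
at most a `ρ₀/2`-fraction of the octaves once `θ = θ(ρ₀)` is small, so an opaque windowed octave `k ≥ ρ₀K/4`
exists; pigeonhole over `n` (finitely many subsets of `[1, K-2]`), then `t → ∞` along (T1).
Why it might fail: the floor is a quasi-multiplicativity LOWER bound for tilted avoidance of a sourced
duplicated cluster by a depleted sourced strand on `ℤ³` — unproved (Brownian/LERW analogues: Lawler 1991
Ch. 3–5, Kozma arXiv:math/0508344, Shiraishi doi:10.1214/16-AOP1165). Size L/XL. [cite: Lawler1991, Ch. 3–5] -/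
theorem stub_opaqueScales : OnePinchTransparencyDecay → OpaqueScalesIO := by
  sorry

/-- **S3 — HARDEST: an opaque octave un-pinches the near end.** From a relative transparency drop `≥ c`
across the octave `Λ_{2^k}∖Λ_{2^{k-1}}` (under the avoidance tilt `𝟙·S(C_{2^{k-1}})`, far ends at scale
`t ≥ 2^{k+2}`) to mean opacity `≥ c'` of a FIXED injective shape dilated by `L ≍ 2^k`, for infinitely many
`L`. Intended proof: (i) restricted switching (`Current.ecurrentSumIn_empty_mul_ecurrentSum_pair`, ADS15
Lemma 2.2) reads `1 - h_k` as the tilted probability that the `(e₂,q_t)`-strand living in `Λ_n ∖ C_{2^{k-1}}`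
is forced through the annulus piece `C ∩ (Λ_{2^k}∖Λ_{2^{k-1}})`; (ii) UN-TILT / one-set decoupling (D): the
laws of the annulus pieces of the explored cluster and of the depleted strand, given the inside, are
dominated up to constants by those of fresh objects sourced on `∂Λ_{2^{k-2}}` (domain Markov for currents,
`Current.tsum_pair_eq_sum_clusterSet`; chain rule `BackboneChainRule*.lean`; ADC21 §6.2 crossing tightness,
printed for `d = 4`); (iii) SOURCE RELOCATION (H): move `0, e₂` to lattice points of `∂Λ_{2^{k-2}}` and
`p_t, q_t` to `2^{k+2}`-scale points at bounded cost — a two-point Harnack inequality at the opaque scale for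
the SOURCED / DEPLETED objects; the deterministic part (ADC21 regularity P1 for `G(0,·)` on
`Λ_{2^{k+3}}∖Λ_{2^{k-3}}`) is supplied by the `DoublingWindow` conjunct of (T2) + MMS folding, the rest (P2-type
gradient control, Duminil-Copin–Panis arXiv:2404.05700 (1.11) `TwoPointGradientEstimate`; insertion
tolerance `CurrentInsertion.lean`) is open on `ℤ³` at an arbitrary windowed scale (ADC21 Def. 5.11/Thm 5.12,
`RegularScales*.lean`, are `d = 4` in tree; Panis arXiv:2406.15243 Def. 5.2/Thm 5.3 for `d = 3`); (iv) antitonicity of `S` (a sub-obstacle suffices for opacity) and a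
pigeonhole over the finite family of relocated shapes. Why it might fail: (D) and (H) for SOURCED currents
on `ℤ³` are exactly the technology the route records as missing; the bet is that at an octave where GAP has
already forced hitting, only one-set, one-scale comparability is needed, never joint conditioning of the
merged pair on boundary flux. Size XL / open. [cite: AizenmanDuminilCopinAnnals2021, §6.2 and Thm 5.12] -/
theorem stub_farOpacity : OpaqueScalesIO → FarOpacityIO := by
  sorry

/-- **S4 — far merging IS mean opacity (exact), back to spins.** Intended proof: in the box, Lemma A.1 with
`F = 𝟙[Ly₀ ↮ Ly₂]` (`Current.tsum_epairWeight_eq_tsum_mul_offRatio`; parity `Ly₂ ∈ C ⇔ Ly₃ ∈ C` under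
`∂n₂ = {Ly₂,Ly₃}`) and the random-current representation of the depleted free-b.c. box state
(`isingCorr_free_box_eq_boxGraph`, `offRatio` = `boxTwoPoint` ratio) give
`P^{Ly₀Ly₁,Ly₂Ly₃}_{Λ_n}[Ly₀ ↔ Ly₂] = 1 - meanTransparency n n (Ly₀) (Ly₁) (Ly₂) (Ly₃) ≥ c`; ADC21 (3.11) in
the box (`connectedFour_free_box_eq`, proved) gives `U₄^{Λ_n}(Ly) = -2 G_nG_n · P_n`; the box limits
`tendsto_connectedFour_box_criticalBeta`, `criticalCorr_wellDefined_holds` and `G(Ly₀,Ly₁)G(Ly₂,Ly₃) > 0`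
(`criticalTwoPoint_bounds_holds`) turn "`≥ c` for infinitely many `n`" into `U₄(Ly) ≤ -c·GG` (measurability
of `clusterTransparency` under the finitely supported box law is part of the work). Size M/L, provable now. [cite: AizenmanDuminilCopinAnnals2021, eq. (3.11) and Lemma A.1] -/
theorem stub_farMerging : FarOpacityIO → FarMergingShape cc2 (criticalCorr 3 4) := by
  sorry

/-! ## Composition: the stubs conclude the crux BY NAME -/

/-- The logic of the line, sorry-free: the four stub STATEMENTS compose to
`EnergyGapPowerLaw → FarMergingShape cc2 (criticalCorr 3 4)`, which is the crux unfolded one step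
(`Negative.SoftShapes.crux_iff`, `Iff.rfl`). Hypotheses are exactly the types of `stub_onePinchDecay`,
`stub_opaqueScales`, `stub_farOpacity`, `stub_farMerging`. [folklore] -/
theorem line_closes
    (h₁ : EnergyGapPowerLaw → OnePinchTransparencyDecay)
    (h₂ : OnePinchTransparencyDecay → OpaqueScalesIO)
    (h₃ : OpaqueScalesIO → FarOpacityIO)
    (h₄ : FarOpacityIO → FarMergingShape cc2 (criticalCorr 3 4)) :
    EnergyGapPowerLaw → FarMergingShape cc2 (criticalCorr 3 4) :=
  fun hgap => h₄ (h₃ (h₂ (h₁ hgap)))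

/-- **The skeleton theorem**: the crux BY NAME from the four declared stubs (the only `sorry`s of the file
live inside `stub_*`; this proof term is `line_closes` applied to them, kernel-checked against the route
decl by `δ`-unfolding). [folklore] -/
theorem GapForcesFarMerging_of :
    Summit.CriticalPhenomena.Ising3DConformalLimit.Theses.EnergyNotSigmaSquared.GapForcesFarMerging :=
  line_closes stub_onePinchDecay stub_opaqueScales stub_farOpacity stub_farMerging

end Summit.CriticalPhenomena.Ising3DConformalLimit.Cruxes.GapForcesFarMerging.BackboneTransparencyDichotomy

end
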